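import Literature.Analysis.FluidPDE.TsaiPressureGrowth
import Literature.Analysis.FluidPDE.TsaiGrowthLemmasProofs
import Literature.Analysis.FluidPDE.StokesInteriorEstimateHolds
import Literature.Analysis.FluidPDE.NormalisedPressureLpBoundProofs
import HarnessLib

/-!
# Tsai 1998, Lemma 3.2 (polynomial growth of the pressure): the discharge

Analysis/FluidPDE proofs file (no definitions, no named facts) for the named fact
`Literature.Analysis.FluidPDE.tsai1998_lemma32` of `TsaiGrowthLemmas.lean` (T.-P. Tsai, *On
Leray's self-similar solutions of the Navier–Stokes equations satisfying local energy
estimates*, Arch. Rational Mech. Anal. 143 (1998) 29–51, **Lemma 3.2**, p. 39: "Let `U` be a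
weak solution of (1.3) and let `P` be defined as in Section 2. If `U ∈ L^q(ℝ³)`, `3 ≤ q ≤ ∞`,
then `|P(y₀)| = O(|y₀|^N)` as `y₀ → ∞` for some `N < ∞`"; the fact renders it for the tree's
pointwise profile class `IsLerayProfile ν a U P`, `ν, a > 0`):

* `tsai1998_lemma32_holds : tsai1998_lemma32` — **the discharge**.

It is the accepted reduction `tsai1998_lemma32_of_facts` (`TsaiPressureGrowth.lean`: Tsai's
§3.2 bootstrap — the local pressure representation and oscillation bound of
`TsaiLocalPressure` / `TsaiLocalPressureSup` / `TsaiPressureBootstrap`, fed by the gradient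
estimate of Lemma 3.1, `TsaiGradientEstimate`) applied to the three discharged analytic inputs
of the tree:

* `tsai1998_profile_smooth_holds` (`TsaiGrowthLemmasProofs.lean`; Tsai p. 33: weak solutions of
  (1.3) are smooth);
* `stokes_interior_Lr_estimate_holds` (`StokesInteriorEstimateHolds.lean`; the interior `L^r`
  estimate (3.2), p. 37, for the Stokes system, from the tree's Calderón–Zygmund theory
  `Literature/Analysis/SingularIntegrals/`);
* `stein1970_normalisedPressure_Lp_bound_holds` (`NormalisedPressureLpBoundProofs.lean`; Stein's
  `L^p` bound for the normalised pressure `RᵢRⱼ(UᵢUⱼ)`, the input of Tsai's Lemma 2.1, used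
  only for `3 ≤ q < 4`).

The trust base of `tsai1998_lemma32` is thereby Mathlib's axioms only (as was already the case
for its consumer in the Theorem 1 line, `tsai_selfsimilar_holds`, which inlines the same three
inputs through `tsai_selfsimilar_of_stokes_facts`). Kept in a separate leaf module rather than
appended to `TsaiGrowthLemmasProofs.lean` so that the latter (the `L^q`-bootstrap proof of
Lemma 3.3) does not acquire the Calderón–Zygmund import chain.

## References

* T.-P. Tsai, *On Leray's self-similar solutions of the Navier–Stokes equations satisfying local
  energy estimates*, Arch. Rational Mech. Anal. 143 (1998) 29–51: Lemma 2.1 (p. 34), (3.2)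
  (p. 37), Lemma 3.2 (p. 39). [Tsai1998]
-/

noncomputable section

namespace Literature.Analysis.FluidPDE

/-- **Discharge of `tsai1998_lemma32`** (Tsai 1998, Lemma 3.2, p. 39: for `ν, a > 0`, a Leray
profile `(U, P)` — `IsLerayProfile ν a U P` — with `U ∈ L^q(ℝ³)` for some `3 ≤ q ≤ ∞` has
`|P(y)| ≤ C |y|^N` for `|y| ≥ R`, for some `N ∈ ℕ` and `C, R`). PROVED:
`tsai1998_lemma32_of_facts` applied to `tsai1998_profile_smooth_holds`,
`stokes_interior_Lr_estimate_holds` and `stein1970_normalisedPressure_Lp_bound_holds`.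
[cite: Tsai1998, Lemma 3.2 (p. 39)] -/
theorem tsai1998_lemma32_holds : tsai1998_lemma32 :=
  tsai1998_lemma32_of_facts tsai1998_profile_smooth_holds stokes_interior_Lr_estimate_holds
    stein1970_normalisedPressure_Lp_bound_holds

end Literature.Analysis.FluidPDE

end
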